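import Literature.AlgebraicGeometry.CossartPiltant200819.GoodResolution2019
import Literature.AlgebraicGeometry.Resolution.ThreefoldResolutionOneBlowup
import Literature.AlgebraicGeometry.Resolution.TransversalUnionSNC
import Literature.AlgebraicGeometry.Resolution.GenericFibreResolutionDatum
import Literature.AlgebraicGeometry.Resolution.BlowupsFlatBaseChange
import Literature.AlgebraicGeometry.Resolution.BlowupChartMembership
import Literature.Topology.KrullDimensionDrop
import HarnessLib

/-!
# Cossart–Piltant 2019, Thm. 1.1 (iii) for threefolds over a field: the good resolution is one blowing up

Topic: `Literature/AlgebraicGeometry/CossartPiltant200819`. Cossart–Piltant prove conclusion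
(iii) of their Thm. 1.1 ("`π⁻¹(Sing 𝒳)` is a strict normal crossings divisor on `𝒳'`") LAST,
from (i)–(ii) and embedded resolution of excellent surfaces (v1 = arXiv:1412.0868v1, §4.1,
p. 50: "Suppose that (i) and (ii) in Theorem 1.1 have been proved. Apply proposition 4.2
[Cossart–Jannsen–Saito, embedded resolution for a reduced closed subscheme of dimension at most
two of an excellent regular scheme, with `ℬ = ∅`] to `𝒳 := π⁻¹(Sing 𝒳)_red ⊆ 𝒳'`, then blow up
along `𝒳'` [the strict transform]: we get (iii)"). This file PROVES that step over Mathlib for an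
integral separated threefold of finite type over a field, on top of the tree's one-blow-up form of
(i)–(ii) (`Resolution.exists_isBlowup_isRegular_of_dim_three`, from the named facts
`CossartPiltant2019General` = Thm. 1.1 (i)(ii), `Stacks081R` = Raynaud–Gruson flattening by one
`U`-admissible blowing up, `CossartPiltant2019Principalization` = CP Prop. 4.4) and the tree's
rendering of CJS 2020 Thm. 1.4 / Cor. 1.5 (`CossartJannsenSaito2020Embedded`):

* `exists_isBlowup_isGoodResolution_of_dim_three` — MAIN: for `X` integral, separated, Noetherian,
  locally of finite type over a field `k`, `dim X = 3`, there are a non-zero ideal sheaf `𝓛` on `X`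
  and a blowing up `π : X' → X` of `X` along `𝓛` which is a GOOD RESOLUTION in the sense of CP 2019
  Thm. 1.1 (i)(ii)(iii) / Cor. 1.2 (`CP2019.IsGoodResolution`: proper birational, `X'` regular, an
  isomorphism over `Reg X`, `π⁻¹(Sing X)` a strict normal crossings divisor, de Jong 2.4).
  Proof. `ρ : T → X`, the regular one-blow-up resolution along `𝓛₀`, `Supp 𝓛₀ ⊆ Sing X`, an
  isomorphism over `U = Reg X`; `S := ρ⁻¹(Sing X) ⊊ T` is closed of dimension `≤ 2` (`T` is
  irreducible of dimension `3`, `Literature.Topology.topologicalKrullDim_lt_of_isClosed_ssubset`);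
  `T` is Noetherian, regular and excellent (finite type over a field, Stacks 07QW), so CJS gives
  `π : Z₁ → T`, a composite of blowings up in regular centres over `S` — hence ONE blowing up along
  some `Q` with `Supp Q ⊆ S` (`IsEmbeddedTransform.exists_isBlowup`) — with `Z₁` regular,
  `π⁻¹(S) = X₁ ∪ B₁`, `B₁` a strict normal crossings divisor and `X₁` (closed, regular) transversal
  to `B₁` (CJS Def. 4.1). Then `π ≫ ρ` is one blowing up of `X` along an `𝓛` with `Supp 𝓛 ⊆ Sing X`
  (Stacks 080B, `IsBlowup.exists_isBlowup_comp_supported`), `𝓛 ≠ 0`; in fact `Supp 𝓛 = Sing X`,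
  because `π ≫ ρ` is an isomorphism off `Supp 𝓛` (Stacks 02OS) and `Z₁` is regular
  (`mem_regularLocus_iff_of_isIso_morphismRestrict`). So `(π ≫ ρ)⁻¹(Sing X) = X₁ ∪ B₁` is the
  support of the effective Cartier divisor `(π ≫ ρ)⁻¹𝓛·𝒪_{Z₁}`: at each point its ideal is the
  radical of a principal ideal `(t)`, `t` a non-zero-divisor, and
  `IsTransversalWith.isStrictNormalCrossingsDivisor_union` (`TransversalUnionSNC.lean`: Krull's
  Hauptidealsatz forces the transversal parameters of `X₁` to be a single `z₁`, and
  `I(X₁ ∪ B₁) = (z₁ ∏_{j∈J} w_j)`) shows that `X₁ ∪ B₁` is a strict normal crossings divisor. No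
  final blowing up "along `𝒳'`" is needed here: the exceptional locus of a blowing up of an
  integral scheme along a non-zero ideal is already purely of codimension one, which is what the
  Hauptidealsatz step records.
* `hasGoodResolution_of_dim_three` — hence `CP2019.HasGoodResolution X` (Thm. 1.1 (i)(ii)(iii) for
  such `X`), and `exists_isGoodResolution_isProjectiveOver_of_dim_three` — for `X` projective over
  `k` the good resolution has `k`-projective source (blowings up of projective schemes are
  projective, Hartshorne II 7.16 (c); compare `CP2019.CossartPiltant2019Thm11Projective`, which is
  chartwise).

What is NOT proved here: Thm. 1.1 (i)(ii) (`CossartPiltant2019General`), Prop. 4.4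
(`CossartPiltant2019Principalization`), Raynaud–Gruson (`Stacks081R`) and CJS Thm. 1.4
(`CossartJannsenSaito2020Embedded`) are hypotheses; the general case of Thm. 1.1 (iii) (reduced
quasi-excellent `𝒳`, arbitrary `π` satisfying (i)(ii), lower-dimensional components of
`π⁻¹(Sing 𝒳)` and the final blowing up along the strict transform) is not treated.

## Sources

* V. Cossart, O. Piltant, *Resolution of singularities of arithmetical threefolds*, J. Algebra 529
  (2019) 268–535 = arXiv:1412.0868: Thm. 1.1, Cor. 1.2 (v1 p. 3); §4.1, Props. 4.2, 4.4 and the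
  paragraph following Prop. 4.4 (v1 p. 50). [CossartPiltant2019]
* V. Cossart, U. Jannsen, S. Saito, *Desingularization: Invariants and Strategy*, LNM 2270 (2020),
  Thm. 1.4, Cor. 1.5 and its proof (p. 7), Def. 4.1. [CossartJannsenSaito2020]
* A. J. de Jong, Publ. Math. IHÉS 83 (1996), 2.4. [DeJong1996]
* The Stacks Project, Tags 080B, 02OS, 02ND, 07QW. [StacksProject]
* R. Hartshorne, *Algebraic Geometry* (1977), II Prop. 7.16 (c). [Hartshorne1977]

AI-generated formalisation (cell `pub-hironaka`, CP carver); the statements proved are the tree's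
renderings (`CP2019.IsGoodResolution`, `IsStrictNormalCrossingsDivisor`), see the faithfulness notes
of `GoodResolution2019.lean` and `StrictNormalCrossings.lean`.
-/

noncomputable section

open CategoryTheory CategoryTheory.Limits AlgebraicGeometry TopologicalSpace IsLocalRing

namespace Literature.AlgebraicGeometry.CossartPiltant200819.CP2019

open Literature.AlgebraicGeometry.Resolution Literature.AlgebraicGeometry.Motives

universe u

open Scheme.IdealSheafData

/-! ## Thm. 1.1 (iii): the one-blow-up resolution of a threefold over a field is good -/

/-- **Cossart–Piltant 2019, Thm. 1.1 (i)(ii)(iii) for an integral separated threefold of finite type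
over a field, realised by ONE blowing up** — given Thm. 1.1 (i)(ii) (`CossartPiltant2019General`),
Raynaud–Gruson flattening (`Stacks081R`), CP Prop. 4.4 (`CossartPiltant2019Principalization`) and
CJS 2020 Thm. 1.4 with `B = ∅` (`CossartJannsenSaito2020Embedded`): there are `𝓛 ≠ 0` and a blowing up
`π : X' → X` of `X` along `𝓛` which is a good resolution of singularities (`IsGoodResolution`:
proper birational with `X'` regular, an isomorphism over `Reg X`, and `π⁻¹(Sing X)` a strict normal
crossings divisor on `X'`). This is CP 2019 §4.1, Step "(iii)" (v1 p. 50: "Apply proposition 4.2 to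
`𝒳 := π⁻¹(Sing 𝒳)_red ⊆ 𝒳'` … we get (iii)") run on the one-blow-up resolution `ρ : T → X` of
`Resolution.exists_isBlowup_isRegular_of_dim_three`; see the module docstring for the proof.
[cite: CossartPiltant2019, Thm. 1.1 (iii); §4.1, Prop. 4.2 and the paragraph after Prop. 4.4 (v1 p. 50)]
[cite: CossartJannsenSaito2020, Thm. 1.4 and p. 7 (proof of Cor. 1.5); Def. 4.1]
[cite: StacksProject, Tag 080B; Tag 02OS] [cite: DeJong1996, 2.4, p. 55] -/
theorem exists_isBlowup_isGoodResolution_of_dim_three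
    (hG : CossartPiltant2019General.{u}) (h081R : Stacks081R.{u})
    (hP : CossartPiltant2019Principalization.{u}) (hE : CossartJannsenSaito2020Embedded.{u})
    {k : Type u} [Field k] {X : Scheme.{u}} [IsIntegral X] [IsNoetherian X] [X.IsSeparated]
    (f : X ⟶ Spec (.of k)) [LocallyOfFiniteType f] (hdimX : topologicalKrullDim X = 3) :
    ∃ (𝓛 : X.IdealSheafData) (X' : Scheme.{u}) (π : X' ⟶ X),
      𝓛 ≠ ⊥ ∧ IsBlowup π 𝓛 ∧ IsGoodResolution π := by
  classical
  -- (1) the regular one-blow-up resolution `ρ : T → X` along `𝓛₀`, an isomorphism over `U = Reg X`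
  obtain ⟨𝓛₀, T, ρ, h𝓛₀ne, hρ, hTreg, U, hU, h𝓛₀supp, hisoU⟩ :=
    exists_isBlowup_isRegular_of_dim_three hG h081R hP f hdimX
  haveI := hisoU
  haveI : IsIntegral T := hρ.isIntegral h𝓛₀ne
  haveI : IsProper ρ := hρ.isProper
  haveI : IsNoetherian T := by
    haveI : IsLocallyNoetherian T := LocallyOfFiniteType.isLocallyNoetherian ρ
    haveI : CompactSpace T := QuasiCompact.compactSpace_of_compactSpace ρ
    exact {}
  have hexcT : Scheme.IsExcellent T :=
    Scheme.isExcellent_of_locallyOfFiniteType Stacks07QW_field_holds (ρ ≫ f)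
  -- `U = Reg X` is non-empty (the generic point is regular)
  have hUne : (U : Set X).Nonempty := by
    refine ⟨genericPoint X, ?_⟩
    rw [hU, Scheme.mem_regularLocus]
    exact inferInstanceAs (IsRegularLocalRing X.functionField)
  have hdimT : topologicalKrullDim T = 3 :=
    (topologicalKrullDim_eq_of_isIso_morphismRestrict f ρ U hUne).trans hdimX
  -- (2) `S = ρ⁻¹(Sing X)`: closed, not everything, of dimension `≤ 2`
  set S : Set T := ρ ⁻¹' (U : Set X)ᶜ with hSdef
  have hS : IsClosed S := U.2.isClosed_compl.preimage ρ.continuous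
  have hSne : S ≠ Set.univ := by
    obtain ⟨x, hx⟩ := hUne
    obtain ⟨x', -⟩ := (ConcreteCategory.bijective_of_isIso (ρ ∣_ U).base).2 ⟨x, hx⟩
    intro hS'
    have hmem : x'.1 ∈ S := hS' ▸ Set.mem_univ _
    exact hmem x'.2
  have hdimS : topologicalKrullDim S ≤ 2 := by
    have hlt := Literature.Topology.topologicalKrullDim_lt_of_isClosed_ssubset hS hSne (2 + 1)
      (by rw [hdimT]; exact_mod_cast (by norm_num : (3 : ℕ) < 2 + 1 + 1))
    rw [Nat.cast_add_one] at hlt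
    exact_mod_cast (ENat.WithBot.lt_add_one_iff.mp hlt)
  -- (3) CJS: embedded resolution of `S ⊆ T`
  obtain ⟨Z₁, π, X₁, B₁, hT, hZ₁reg, -, -, -, -, hB₁, htot, htr⟩ :=
    hE.of_isClosed T hTreg hexcT S hS hdimS
  have hX₁c : IsClosed X₁ := hT.isClosed_transform hS
  -- `π` is one blowing up along `Q`, `Supp Q ⊆ S`; `π ≫ ρ` is one blowing up along `𝓛`,
  -- `Supp 𝓛 ⊆ Sing X`
  obtain ⟨Q, hQ, hQS⟩ := hT.exists_isBlowup
  obtain ⟨𝓛, h𝓛, h𝓛supp⟩ :=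
    IsBlowup.exists_isBlowup_comp_supported ρ 𝓛₀ π Q ((U : Set X)ᶜ) hρ h𝓛₀supp hQ hQS
  have h𝓛ne : 𝓛 ≠ ⊥ := by
    intro h0
    obtain ⟨x, hx⟩ := hUne
    have hmem : x ∈ (𝓛.support : Set X) := by rw [h0, support_bot]; trivial
    exact h𝓛supp hmem hx
  -- (4) `Supp 𝓛 = Sing X`: off `Supp 𝓛`, `π ≫ ρ` is an isomorphism from the regular `Z₁`
  have hUsupp : (𝓛.support : Set X)ᶜ ⊆ (U : Set X) := by
    intro x hx
    let W : X.Opens := ⟨(𝓛.support : Set X)ᶜ, 𝓛.support.isClosed.isOpen_compl⟩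
    haveI : IsIso ((π ≫ ρ) ∣_ W) := h𝓛.isIso_compl
    obtain ⟨z, hz⟩ := (ConcreteCategory.bijective_of_isIso ((π ≫ ρ) ∣_ W).base).2 ⟨x, hx⟩
    have hzx : (π ≫ ρ) z.1 = x := by
      have h1 := congrArg Subtype.val hz
      rwa [morphismRestrict_base_coe] at h1
    have hzreg : z.1 ∈ Scheme.regularLocus Z₁ := by
      rw [hZ₁reg.regularLocus_eq_univ]; trivial
    have hxreg := (mem_regularLocus_iff_of_isIso_morphismRestrict (π ≫ ρ) W z.1 z.2).mp hzreg
    rw [hzx] at hxreg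
    rwa [hU]
  have hsuppEq : (𝓛.support : Set X) = (U : Set X)ᶜ :=
    Set.Subset.antisymm h𝓛supp (Set.compl_subset_comm.mp hUsupp)
  -- (5) the exceptional locus `(π ≫ ρ)⁻¹(Sing X) = π⁻¹(S) = X₁ ∪ B₁` is the support of the
  -- effective Cartier divisor `(π ≫ ρ)⁻¹ 𝓛 · 𝒪_{Z₁}`
  have hpre : (π ≫ ρ).base ⁻¹' (Scheme.regularLocus X)ᶜ = X₁ ∪ B₁ := by
    rw [← htot, ← hU]
    exact Set.ext fun _ => Iff.rfl
  have hcl : (⟨closure (X₁ ∪ B₁), isClosed_closure⟩ : Closeds Z₁) = (𝓛.comap (π ≫ ρ)).support := by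
    apply Closeds.ext
    change closure (X₁ ∪ B₁) = ((𝓛.comap (π ≫ ρ)).support : Set Z₁)
    rw [(hX₁c.union hB₁.isClosed).closure_eq, support_comap, Closeds.coe_preimage, hsuppEq, ← htot,
      hSdef]
    rfl
  have hsnc : IsStrictNormalCrossingsDivisor Z₁ (X₁ ∪ B₁) := by
    refine htr.isStrictNormalCrossingsDivisor_union hB₁ hX₁c fun x _ => ?_
    obtain ⟨t, ht, hst⟩ := h𝓛.isEffectiveCartier.exists_stalkIdeal_eq_span x
    refine ⟨t, nonZeroDivisors.ne_zero ht, ?_⟩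
    rw [hcl, vanishingIdeal_support, stalkIdeal_radical, hst]
  -- (6) read off
  refine ⟨𝓛, Z₁, π ≫ ρ, h𝓛ne, h𝓛, ⟨h𝓛.isProper, h𝓛.isBirational' h𝓛ne, hZ₁reg⟩,
    ⟨U, hU, h𝓛.isIso_morphismRestrict ?_⟩, hpre ▸ hsnc⟩
  exact Set.disjoint_left.mpr fun x hx hx' => h𝓛supp hx' hx

/-- **CP 2019 Thm. 1.1 (i)(ii)(iii) for integral separated threefolds of finite type over a field**,
from Thm. 1.1 (i)(ii), Raynaud–Gruson, Prop. 4.4 and CJS Thm. 1.4: `X` has a good resolution of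
singularities (`HasGoodResolution`, the conclusion of the named fact `CossartPiltant2019Thm11`).
[cite: CossartPiltant2019, Thm. 1.1; Cor. 1.2] -/
theorem hasGoodResolution_of_dim_three
    (hG : CossartPiltant2019General.{u}) (h081R : Stacks081R.{u})
    (hP : CossartPiltant2019Principalization.{u}) (hE : CossartJannsenSaito2020Embedded.{u})
    {k : Type u} [Field k] {X : Scheme.{u}} [IsIntegral X] [IsNoetherian X] [X.IsSeparated]
    (f : X ⟶ Spec (.of k)) [LocallyOfFiniteType f] (hdimX : topologicalKrullDim X = 3) :
    HasGoodResolution X := by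
  obtain ⟨-, X', π, -, -, hπ⟩ := exists_isBlowup_isGoodResolution_of_dim_three hG h081R hP hE f hdimX
  exact ⟨X', π, hπ⟩

/-! ## Projective threefolds -/

/-- **An integral projective threefold over any field has a good resolution with `k`-projective
source**, given CP 2019 Thm. 1.1 (i)(ii), Raynaud–Gruson flattening, CP Prop. 4.4 and CJS Thm. 1.4:
the good resolution of `exists_isBlowup_isGoodResolution_of_dim_three` is a blowing up of `X`, and
blowings up of projective `k`-schemes are projective over `k` (Hartshorne II 7.16 (c), the tree's
PROVED `IsBlowup.isProjectiveOver`). Compare CP 2019's chartwise complement to Thm. 1.1 ("one may take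
`π⁻¹(𝒰ᵢ) → 𝒰ᵢ` projective", `CP2019.CossartPiltant2019Thm11Projective`) and Cutkosky 2009, Thm. 1.1
(`k` algebraically closed, `char k ≠ 2, 3, 5`, without (iii)).
[cite: CossartPiltant2019, Thm. 1.1 and the sentence following (iii) (v1 p. 3)]
[cite: Hartshorne1977, II Prop. 7.16 (c), p. 166] -/
theorem exists_isGoodResolution_isProjectiveOver_of_dim_three
    (hG : CossartPiltant2019General.{u}) (h081R : Stacks081R.{u})
    (hP : CossartPiltant2019Principalization.{u}) (hE : CossartJannsenSaito2020Embedded.{u})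
    {k : Type u} [Field k] {X : Scheme.{u}} [IsIntegral X] (f : X ⟶ Spec (.of k))
    (hproj : IsProjectiveOver (Over.mk f : SchemeOver k)) (hdimX : topologicalKrullDim X = 3) :
    ∃ (X' : Scheme.{u}) (π : X' ⟶ X), IsGoodResolution π ∧
      IsProjectiveOver (Over.mk (π ≫ f) : SchemeOver k) := by
  haveI : IsProper f := hproj.isProper
  haveI : X.IsSeparated := Scheme.isSeparated_of_isSeparated_over f
  haveI : IsNoetherian X := Scheme.isNoetherian_of_finiteType_over_field f
  obtain ⟨𝓛, X', π, -, h𝓛, hπ⟩ := exists_isBlowup_isGoodResolution_of_dim_three hG h081R hP hE f hdimX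
  exact ⟨X', π, hπ, h𝓛.isProjectiveOver f hproj⟩

end Literature.AlgebraicGeometry.CossartPiltant200819.CP2019

end
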